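import Summits.Ventures.CertifiedQuantumChemistry.Rows.HubbardRingStrongCouplingLimit
import Summits.Ventures.CertifiedQuantumChemistry.Rows.HubbardRingL6StrongCouplingForm
import HarnessLib

/-!
# Ventures/CertifiedQuantumChemistry — Rows/HubbardRingL6StrongCouplingLimit.lean: the strong-coupling
# constant of the half-filled Hubbard 6-ring, `lim_{U→∞} U·E₀(6;U) = −2(5 + √13)` (T-K0-6, part 2 of 2)

HONEST FRAMING (verbatim): certified bounds for a stated model Hamiltonian in a stated basis; not a
claim about the real molecule beyond that model.

Seat ref/typer (`pub-qchem-typer`, gen 19); the 6-ring analogue of T-K0-4 (`Rows/HubbardRingStrongCouplingLimit.lean`),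
NOTED by the lead (HOME/INBOX L802 (2), RULINGS TYP-47: 'NOT asked, no clock, the typer's discretion').
THEOREMS ONLY (no `def`, no claim node, no row), zero compute, standard axioms; NOT a row, scores nothing,
moves no `CERTIFIED.md` byte. With `Rows/HubbardHalfFilledStrongCoupling.lean` (Kato's second-order limit at
half filling, any graph) and part 1 (`Rows/HubbardRingL6StrongCouplingForm.lean`: the form bound
`Q ≤ (10 + 2√13)|x|²` with equality at the Perron vector) this file proves:

* §7 (coordinates, as §3 of the 4-ring file with `r6s3 / r6K3 / r6d33`, sector `(3,3)`):
  `ring6_re_norm_eq`, `ring6_re_norm_mulVec_eq` (‖φ‖², ‖Aφ‖² of a vector supported on the twenty singly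
  occupied `(3,3)` configurations, `A = hamiltonian (ringGraph 6) 1 0`), `ring6_re_norm_mulVec_le`
  (`‖Aφ‖² ≤ (10 + 2√13)‖φ‖²`), `ring6_witness` (a supported `φ₀ ≠ 0` with `‖Aφ₀‖² = (10 + 2√13)‖φ₀‖²`: the
  Perron vector on the antidiagonal), **`ring6_minEnergyOn_neg_sq`**: `E_{K₀}(−A²) = −(10 + 2√13)`.
* §8 **`tendsto_mul_energy_hubbardRingTV_six`**:
  `Tendsto (fun U : ℚ => (U : ℝ) * (hubbardRingTV 6 1 U).energy 3 3) atTop (𝓝 (-(2 * (5 + Real.sqrt 13))))`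
  and **`tendsto_mul_minEnergyOn_szSector_hubbardRingTV_six`** (the `….hamiltonian.minEnergyOn (szSector 6 0)`
  spelling): for the TV-H file of the 6-ring (`t = 1`, `U ∈ ℚ`), `U·E₀(6;U) → −2(5 + √13) = −4·h(6)`,
  `h(6) = (5 + √13)/2` the Heisenberg 6-ring constant of `HOME/STRUCTURE.md` §2.2.3 / §2.2.14.2 — the
  model-energy half of the L = 6 plateau statements, kernel-proved.

Not claimed: nothing about any relaxation value `OPT_X`; no rate in `1/U`; rings `L ≥ 8`.

References: as T-K0-4 [Kato1966], [Takahashi1999], [LiebPRL1989]. Typer `pub-qchem-typer` (gen 19), 0 core-h.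
-/

noncomputable section

namespace Summit.Ventures.CertifiedQuantumChemistry

open Matrix Finset Filter Topology
open Literature.MathematicalPhysics.QuantumLattice Literature.MathematicalPhysics.QuantumChemistry
open Literature.MathematicalPhysics.QuantumLattice.TwoSpecies LiebThm1
open Summit.Ventures.CertifiedQuantumChemistry.Hamiltonians

/-! ## §7 The half-filled 6-ring in Lieb's coordinates: `E_{K₀}(−A²) = −(10 + 2√13)` -/

section Ring6

variable {φ : Fock (Orb (Fin 6))}

/-- A vector supported on the singly occupied `(3,3)` configurations lies in the sector `(3,3)`. -/
theorem ring6_isInSector_of_supported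
    (hφ : ∀ s : Finset (Orb (Fin 6)), ¬(((upPart s).card = 3 ∧ (downPart s).card = 3) ∧
      (doublyOccupied s).card = 0) → φ s = 0) : IsInSector 3 3 φ :=
  fun s hs => hφ s fun h => hs h.1

/-- Its Lieb coordinates vanish off the antidiagonal of `r6s3 × r6s3`. -/
theorem ring6_coeffMatrix_eq_zero
    (hφ : ∀ s : Finset (Orb (Fin 6)), ¬(((upPart s).card = 3 ∧ (downPart s).card = 3) ∧
      (doublyOccupied s).card = 0) → φ s = 0) {i j : Fin 20} (hij : j ≠ i.rev) :
    coeffMatrix φ (r6s3 i) (r6s3 j) = 0 := by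
  rw [coeffMatrix_apply, hφ _ ?_, mul_zero]
  rw [doublyOccupied, upPart_pairSet, downPart_pairSet, card_r6s3_inter]
  exact fun h => hij ((r6d33_eq_zero_iff i j).1 h.2)

/-- `‖φ‖² = Σ_i |w_i|²` with `w_i = W(φ)(r6s3 i, r6s3 (rev i))`, for `φ` supported on the singly occupied
`(3,3)` configurations. -/
theorem ring6_re_norm_eq
    (hφ : ∀ s : Finset (Orb (Fin 6)), ¬(((upPart s).card = 3 ∧ (downPart s).card = 3) ∧
      (doublyOccupied s).card = 0) → φ s = 0) :
    (star φ ⬝ᵥ φ).re = ∑ i : Fin 20, ‖coeffMatrix φ (r6s3 i) (r6s3 i.rev)‖ ^ 2 := by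
  rw [re_sector_norm_eq isSubsetEnum_r6s3 isSubsetEnum_r6s3 (ring6_isInSector_of_supported hφ),
    normSqW]
  refine Finset.sum_congr rfl fun i _ => ?_
  rw [Finset.sum_eq_single_of_mem i.rev (Finset.mem_univ _)]
  intro j _ hj
  rw [ring6_coeffMatrix_eq_zero hφ hj, norm_zero, zero_pow two_ne_zero]

/-- `‖Aφ‖² = Σ_{ij} |K_{i,rev j} w_{rev j} + w_i K_{rev i,j}|²` (Lieb's `W(Aφ) = K W + W K` read on the
`(3,3)` sector of the 6-ring) for `φ` supported on the singly occupied configurations. -/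
theorem ring6_re_norm_mulVec_eq
    (hφ : ∀ s : Finset (Orb (Fin 6)), ¬(((upPart s).card = 3 ∧ (downPart s).card = 3) ∧
      (doublyOccupied s).card = 0) → φ s = 0) :
    (star (hamiltonian (ringGraph 6) 1 0 *ᵥ φ) ⬝ᵥ (hamiltonian (ringGraph 6) 1 0 *ᵥ φ)).re =
      ∑ i : Fin 20, ∑ j : Fin 20, ‖(r6K3 i j.rev : ℂ) * coeffMatrix φ (r6s3 j.rev) (r6s3 j.rev.rev) +
        coeffMatrix φ (r6s3 i) (r6s3 i.rev) * (r6K3 i.rev j : ℂ)‖ ^ 2 := by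
  have hsec : IsInSector 3 3 φ := ring6_isInSector_of_supported hφ
  have hsecA : IsInSector 3 3 (hamiltonian (ringGraph 6) 1 0 *ᵥ φ) :=
    (preservesSectors_hamiltonian (ringGraph 6) 1 0).isInSector_mulVec hsec
  have hW0 : ∀ α β : Finset (Fin 6), ¬(α.card = 3 ∧ β.card = 3) → coeffMatrix φ α β = 0 :=
    (isInSector_iff_coeffMatrix 3 3 φ).1 hsec
  have hcoord : ∀ i j : Fin 20, coeffMatrix (hamiltonian (ringGraph 6) 1 0 *ᵥ φ) (r6s3 i) (r6s3 j) =
      (r6K3 i j.rev : ℂ) * coeffMatrix φ (r6s3 j.rev) (r6s3 j.rev.rev) +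
        coeffMatrix φ (r6s3 i) (r6s3 i.rev) * (r6K3 i.rev j : ℂ) := by
    intro i j
    rw [coeffMatrix_hamiltonian_mulVec, Complex.ofReal_zero, zero_smul, add_zero, Matrix.add_apply,
      Matrix.mul_apply, Matrix.mul_apply]
    rw [isSubsetEnum_r6s3.sum_eq (fun γ => hoppingMatrix (ringGraph 6) 1 (r6s3 i) γ *
        coeffMatrix φ γ (r6s3 j)) (fun γ hγ => by rw [hW0 γ _ (fun h => hγ h.1), mul_zero]),
      isSubsetEnum_r6s3.sum_eq (fun β => coeffMatrix φ (r6s3 i) β *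
        hoppingMatrix (ringGraph 6) 1 β (r6s3 j)) (fun β hβ => by rw [hW0 _ β (fun h => hβ h.2), zero_mul])]
    simp only [hoppingMatrix_r6s3]
    congr 1
    · rw [Finset.sum_eq_single_of_mem j.rev (Finset.mem_univ _)]
      · rw [Fin.rev_rev]
      · intro i' _ hi'
        rw [ring6_coeffMatrix_eq_zero hφ (show j ≠ i'.rev from fun h => hi' (by rw [h, Fin.rev_rev])),
          mul_zero]
    · rw [Finset.sum_eq_single_of_mem i.rev (Finset.mem_univ _)]
      intro j' _ hj'
      rw [ring6_coeffMatrix_eq_zero hφ hj', zero_mul]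
  rw [re_sector_norm_eq isSubsetEnum_r6s3 isSubsetEnum_r6s3 hsecA, normSqW]
  simp only [hcoord]

/-- **LOWER half of `E_{K₀}(−A²) = −(10 + 2√13)`**: `‖Aφ‖² ≤ (10 + 2√13) ‖φ‖²` for every `φ` supported on the
singly occupied `(3,3)` configurations of the 6-ring. -/
theorem ring6_re_norm_mulVec_le
    (hφ : ∀ s : Finset (Orb (Fin 6)), ¬(((upPart s).card = 3 ∧ (downPart s).card = 3) ∧
      (doublyOccupied s).card = 0) → φ s = 0) :
    (star (hamiltonian (ringGraph 6) 1 0 *ᵥ φ) ⬝ᵥ (hamiltonian (ringGraph 6) 1 0 *ᵥ φ)).re ≤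
      (10 + 2 * Real.sqrt 13) * (star φ ⬝ᵥ φ).re := by
  rw [ring6_re_norm_mulVec_eq hφ, ring6_re_norm_eq hφ]
  exact ring6_complexForm_le fun k => coeffMatrix φ (r6s3 k) (r6s3 k.rev)

/-- **UPPER half: the witness.** The Perron vector `w = α + β√13` of §6, placed on the antidiagonal,
gives a vector `φ₀ ≠ 0` supported on the singly occupied `(3,3)` configurations with
`‖Aφ₀‖² = (10 + 2√13) ‖φ₀‖²`. -/
theorem ring6_witness : ∃ φ : Fock (Orb (Fin 6)),
    (∀ s : Finset (Orb (Fin 6)), ¬(((upPart s).card = 3 ∧ (downPart s).card = 3) ∧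
      (doublyOccupied s).card = 0) → φ s = 0) ∧ 0 < (star φ ⬝ᵥ φ).re ∧
    (star (hamiltonian (ringGraph 6) 1 0 *ᵥ φ) ⬝ᵥ (hamiltonian (ringGraph 6) 1 0 *ᵥ φ)).re =
      (10 + 2 * Real.sqrt 13) * (star φ ⬝ᵥ φ).re := by
  obtain ⟨w, hwpos, hweq⟩ := ring6_realForm_le_and_eq.2
  set φ : Fock (Orb (Fin 6)) := ofSectorArray r6s3 r6s3
    (fun i j => if j = i.rev then ((w i : ℝ) : ℂ) else 0) with hφdef
  have hsupp : ∀ s : Finset (Orb (Fin 6)), ¬(((upPart s).card = 3 ∧ (downPart s).card = 3) ∧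
      (doublyOccupied s).card = 0) → φ s = 0 := by
    intro s hs
    by_contra hne
    rw [hφdef, ofSectorArray, ofCoeffMatrix] at hne
    obtain ⟨i, -, hi⟩ := Finset.exists_ne_zero_of_sum_ne_zero (right_ne_zero_of_mul hne)
    obtain ⟨j, -, hj⟩ := Finset.exists_ne_zero_of_sum_ne_zero hi
    by_cases hc : r6s3 i = upPart s ∧ r6s3 j = downPart s
    · rw [if_pos hc] at hj
      by_cases hji : j = i.rev
      · apply hs
        rw [doublyOccupied, ← hc.1, ← hc.2, isSubsetEnum_r6s3.card_eq, isSubsetEnum_r6s3.card_eq,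
          card_r6s3_inter, (r6d33_eq_zero_iff i j).2 hji]
        exact ⟨⟨rfl, rfl⟩, rfl⟩
      · exact hj (if_neg hji)
    · exact hj (if_neg hc)
  have hw : ∀ i j : Fin 20, coeffMatrix φ (r6s3 i) (r6s3 j) = if j = i.rev then ((w i : ℝ) : ℂ) else 0 :=
    fun i j => coeffMatrix_ofSectorArray isSubsetEnum_r6s3 isSubsetEnum_r6s3 _ i j
  have hnorm : (star φ ⬝ᵥ φ).re = ∑ a : Fin 20, w a ^ 2 := by
    rw [ring6_re_norm_eq hsupp]
    simp only [hw, if_true, Complex.norm_real, Real.norm_eq_abs, sq_abs]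
  refine ⟨φ, hsupp, ?_, ?_⟩
  · rw [hnorm]
    exact Finset.sum_pos (fun a _ => pow_pos (hwpos a) 2) Finset.univ_nonempty
  · rw [ring6_re_norm_mulVec_eq hsupp, hnorm]
    simp only [hw, Fin.rev_rev, if_true]
    have hcast : ∀ p q : Fin 20,
        ‖(r6K3 p q.rev : ℂ) * ((w q.rev : ℝ) : ℂ) + ((w p : ℝ) : ℂ) * (r6K3 p.rev q : ℂ)‖ ^ 2 =
          ((r6K3 p q.rev : ℝ) * w q.rev + w p * (r6K3 p.rev q : ℝ)) ^ 2 := by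
      intro p q
      rw [← Complex.ofReal_intCast, ← Complex.ofReal_intCast, ← Complex.ofReal_mul, ← Complex.ofReal_mul,
        ← Complex.ofReal_add, Complex.norm_real, Real.norm_eq_abs, sq_abs]
    simp only [hcast]
    exact hweq

/-- **`E_{K₀}(−A²) = −(10 + 2√13) = −2(5 + √13)` for the half-filled 6-ring**: the second-order coefficient
of Kato's reduction (`K₀` = the coordinate subspace of the twenty singly occupied `(3,3)` configurations,
entering through its membership characterisation; `A = H(1,0)` the hopping Hamiltonian of the 6-ring). -/
theorem ring6_minEnergyOn_neg_sq {K₀ : Submodule ℂ (Fock (Orb (Fin 6)))}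
    (hK₀ : ∀ ψ, ψ ∈ K₀ ↔ ∀ s : Finset (Orb (Fin 6)),
      ¬(((upPart s).card = 3 ∧ (downPart s).card = 3) ∧ (doublyOccupied s).card = 0) → ψ s = 0) :
    (-(hamiltonian (ringGraph 6) 1 0 * hamiltonian (ringGraph 6) 1 0)).minEnergyOn K₀ =
      -(10 + 2 * Real.sqrt 13) := by
  have hA := hamiltonian_zero_isHermitian (ringGraph 6) 1
  obtain ⟨φ₀, hφ₀, hn, hAn⟩ := ring6_witness
  have hφ₀K : φ₀ ∈ K₀ := (hK₀ φ₀).2 hφ₀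
  have hAA : (-(hamiltonian (ringGraph 6) 1 0 * hamiltonian (ringGraph 6) 1 0)).IsHermitian := by
    have h2 : (hamiltonian (ringGraph 6) 1 0 * hamiltonian (ringGraph 6) 1 0).IsHermitian := by
      rw [IsHermitian, conjTranspose_mul, hA.eq]
    exact h2.neg
  refine le_antisymm ?_ ?_
  · -- Rayleigh–Ritz with the witness
    have h := minEnergyOn_mul_le_re_rayleigh hAA K₀ hφ₀K
    rw [re_star_dotProduct_neg_mul_self_mulVec hA, hAn] at h
    -- `E · n ≤ -(μ n)` with `n > 0`
    have h' : (-(hamiltonian (ringGraph 6) 1 0 * hamiltonian (ringGraph 6) 1 0)).minEnergyOn K₀ *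
        (star φ₀ ⬝ᵥ φ₀).re ≤ -(10 + 2 * Real.sqrt 13) * (star φ₀ ⬝ᵥ φ₀).re := by linarith
    exact le_of_mul_le_mul_right h' hn
  · have hφ₀0 : φ₀ ≠ 0 := by
      intro h0
      rw [h0, dotProduct_zero, Complex.zero_re] at hn
      exact lt_irrefl _ hn
    obtain ⟨c, -, -, hc1⟩ := EigenvalueContinuation.exists_normalize hφ₀0
    refine le_csInf ⟨_, _, K₀.smul_mem _ hφ₀K, hc1, rfl⟩ ?_
    rintro E ⟨ψ, hψK, hψ1, rfl⟩
    rw [re_star_dotProduct_neg_mul_self_mulVec hA]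
    have hle := ring6_re_norm_mulVec_le ((hK₀ ψ).1 hψK)
    rw [hψ1, Complex.one_re, mul_one] at hle
    linarith

end Ring6

/-! ## §8 The strong-coupling constant of the half-filled Hubbard 6-ring, `lim U·E₀(6;U) = −2(5 + √13)` -/

section Main6

/-- **T-K0-6 (the 6-ring analogue of T-K0-4).** For the TV-H integral file of the 6-site Hubbard ring
(`hubbardRingTV 6 1 U`: `t = 1`, `(pp|pp) = U ∈ ℚ`) the cell's QUANTITY `Model.energy _ 3 3 = E₀(H_F;
N_α = N_β = 3)` satisfies `U · E₀ → −2(5 + √13)` as `U → ∞` along `ℚ` — the exact strong-coupling constant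
of the 6-ring (`= −4·h(6)`, `h(6) = (5 + √13)/2` the Heisenberg 6-ring constant of `HOME/STRUCTURE.md`
§2.2.3 / §2.2.14.2). -/
theorem tendsto_mul_energy_hubbardRingTV_six :
    Tendsto (fun U : ℚ => (U : ℝ) * (hubbardRingTV 6 1 U).energy 3 3) atTop
      (𝓝 (-(2 * (5 + Real.sqrt 13)))) := by
  classical
  set Z : Finset (Finset (Orb (Fin 6))) := univ.filter fun s =>
    ((upPart s).card = 3 ∧ (downPart s).card = 3) ∧ (doublyOccupied s).card = 0 with hZ
  set K₀ : Submodule ℂ (Fock (Orb (Fin 6))) :=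
    Submodule.pi ((Z : Set (Finset (Orb (Fin 6))))ᶜ) (fun _ => (⊥ : Submodule ℂ ℂ)) with hK₀def
  have hK₀ : ∀ ψ, ψ ∈ K₀ ↔ ∀ s : Finset (Orb (Fin 6)),
      ¬(((upPart s).card = 3 ∧ (downPart s).card = 3) ∧ (doublyOccupied s).card = 0) →
        ψ s = 0 := by
    intro ψ
    rw [mem_pi_compl_bot_iff]
    simp only [hZ, Finset.mem_filter, Finset.mem_univ, true_and]
  have hne : ∃ s : Finset (Orb (Fin 6)),
      ((upPart s).card = 3 ∧ (downPart s).card = 3) ∧ (doublyOccupied s).card = 0 :=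
    ⟨pairSet {0, 1, 2} {3, 4, 5}, by rw [doublyOccupied, upPart_pairSet, downPart_pairSet]; decide⟩
  have hgen := tendsto_mul_minEnergyOn_hamiltonian_halfFilled (ringGraph 6) 1 (a := 3) (b := 3)
    (by simp) hK₀ hne
  rw [ring6_minEnergyOn_neg_sq hK₀,
    show -(10 + 2 * Real.sqrt 13) = -(2 * (5 + Real.sqrt 13)) by ring] at hgen
  have h := hgen.comp (tendsto_ratCast_atTop_iff.2 tendsto_id)
  refine h.congr fun U => ?_
  simp only [Function.comp_apply, id_eq, Model.energy, sectorGroundEnergy_def,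
    hubbardRingTV_hamiltonian_eq_one]

/-- The same limit on the matrix and the joint sector:
`U · E_{szSector 6 0}(Model.hamiltonian (hubbardRingTV 6 1 U)) → −2(5 + √13)`. -/
theorem tendsto_mul_minEnergyOn_szSector_hubbardRingTV_six :
    Tendsto (fun U : ℚ => (U : ℝ) * (hubbardRingTV 6 1 U).hamiltonian.minEnergyOn (szSector 6 0)) atTop
      (𝓝 (-(2 * (5 + Real.sqrt 13)))) := by
  refine tendsto_mul_energy_hubbardRingTV_six.congr fun U => ?_
  rw [Model.energy, sectorGroundEnergy_def, ← szSector_two_mul_zero_eq 3]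

end Main6

end Summit.Ventures.CertifiedQuantumChemistry

end
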